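import Summits.BirchSwinnertonDyer.BirchSwinnertonDyer.Theorems.GenusKolyvaginAtTwoShaCardDvdPowAtTwoRTPairCount
import Summits.BirchSwinnertonDyer.BirchSwinnertonDyer.Theorems.GenusKolyvaginAtTwoShaCardDvdPowAtTwoRTSandwich
import Summits.BirchSwinnertonDyer.BirchSwinnertonDyer.Theorems.GenusKolyvaginAtTwoShaCardDvdPowAtTwoRTOnCut
import Summits.BirchSwinnertonDyer.BirchSwinnertonDyer.Theorems.GenusKolyvaginAtTwoPowDvdShaCardAtTwoRT
import Summits.BirchSwinnertonDyer.BirchSwinnertonDyer.Theorems.GenusKolyvaginAtTwoEquivariantKolyvaginExactAtTwoRTOnCut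
import Summits.BirchSwinnertonDyer.BirchSwinnertonDyer.Theorems.GenusKolyvaginAtTwoOffCutResidualAtTwoRLw2FlatRankDescent
import Summits.BirchSwinnertonDyer.BirchSwinnertonDyer.Theorems.GenusKolyvaginAtTwoOffCutResidualAtTwoRLw2FlatSharpExponentRat
import Summits.BirchSwinnertonDyer.BirchSwinnertonDyer.Theorems.GenusKolyvaginAtTwoOffCutResidualAtTwoRLw2FlatShaFinite
import Summits.BirchSwinnertonDyer.BirchSwinnertonDyer.Theorems.GenusKolyvaginAtTwoOffCutResidualAtTwoRLw2FlatShaFiniteRat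
import Summits.BirchSwinnertonDyer.BirchSwinnertonDyer.Theorems.GenusKolyvaginAtTwoOffCutResidualAtTwoRLw2FlatSockets
import Summits.BirchSwinnertonDyer.BirchSwinnertonDyer.Theorems.GenusKolyvaginAtTwoOffCutResidualAtTwoRLw2FlatSandwich
import HarnessLib

/-!
# Route `GenusKolyvaginAtTwo`, LINE 26 «lw2_phantom_exclusion» of the residual crux `OffCutResidualAtTwoR` (stmt-BirchSwinnertonDyer-31767):
# the FLAT re-thread — part E: **U_T, L_T and Q3R_T on the cut — LINE 26 stub `stub_Q3flat` PROVED VERBATIM — from `(NPh at 2N)` instead of an odd multiplicative prime**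

Seat `bsd-line-gk2-p5` g40 (WIDTH-5 attach, cell `bsd-f1-sign2`), `--supports stmt-BirchSwinnertonDyer-31767` (helper; closes nothing).
THEOREMS ONLY (no definition, no named fact, no `sorry`).  **BSD is NOT proved by any of this**; the residual crux is NOT closed by it.
Same surgery as parts A1/A2 (`…Lw2FlatRankDescent`, `…Lw2FlatSharpExponentRat`; see their module docstrings): the binder quadruple
`(v) (h2v) (hNv) (hmult)` of the landed Q3R_T / Q4_T″ cone is replaced by the hypothesis `hNPh : (NPh at 2N)(E, K)` (VERBATIM the conclusion of
`GenusExact.NonPhantomPow.nonPhantomAtTwo_of_hasMultiplicativeReductionAt`), inserted after the two `¬ IsSquare` clauses; proofs are the landed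
ones verbatim with `_flat` callees; decl names = originals + `_flat`; namespaces unchanged.

WHAT (this part).  The top of the Q3R_T cone: PAIRCOUNT (`stub_shaRatCardDvdOfMinimalTwin`), SANDWICH′ (`stub_sandwichOfMinimalTwin`), U_T on the cut
(`shaCardDvdPowAtTwoRT_onCut`), L_T (`powDvdShaCardAtTwoRT_proof`, road (E4): capstone fed with `rank E(K) ≤ 1` and the Kolyvagin-supplies package),
Q3R_T on the cut (`natCard_primaryComponent_sha_two_eq_pow_onCut`), and **`Lw2PhantomExclusion.q3flat` = LINE 26 STUB `stub_Q3flat` VERBATIM**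
(`#Ш(E/K)[2^∞] = 2^(2M₀)` on the habitat cut with `(NPh at 2N)(E, K)` in place of the odd multiplicative prime).  Imports parts A1–D.
-/

set_option autoImplicit false
-- the Theorems namespace of this sub repeats the summit name by design (D-0017 nested layout)
set_option linter.dupNamespace false

noncomputable section

/-! ## from `GenusKolyvaginAtTwoShaCardDvdPowAtTwoRTPairCount` -/

open scoped Classical
open scoped AddSubgroup

namespace Summit.BirchSwinnertonDyer.BirchSwinnertonDyer.Theorems.GenusExact.RationalPairDescent

open WeierstrassCurve NumberField IsDedekindDomain Field Literature.NumberTheory.EllipticCurves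
  Literature.NumberTheory.GaloisRepresentations Literature.NumberTheory.EllipticCurves.ModularForms
open Literature.NumberTheory
open Summit.BirchSwinnertonDyer.BirchSwinnertonDyer.Theses.GenusKolyvaginAtTwo
open Summit.BirchSwinnertonDyer.BirchSwinnertonDyer.Theorems.GenusExact.PlusDescent

/-- (LINE 26 FLAT form: the hypothesis `(NPh at 2N)(E, K)` replaces the odd multiplicative prime `v`.) **Stub PAIRCOUNT of LINE 19 v1.1, BY NAME and UNCONDITIONAL (modulo the crux's antecedent Q2)**: on U_T's frame with `w(E) = 1` and a
2-Selmer-minimal globally minimal twin model `Wd ≅ E^(d_K)` with `ord₂ c(Wd) ≤ 1`: **`#Ш(E/ℚ)[2^∞] ∣ 2^(2M₀)`** — Kolyvagin over `ℚ` at `2`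
for the rank-zero member = (B2Q) + (RANKQ) + (CTQ), see the module docstring. [cite: Kolyvagin1989Izv, Thm. B₂, §3]
[cite: McCallumLMS1991, §1 Theorem] [cite: MazurRubin2010, Cor. 3.4 (i)] -/
theorem stub_shaRatCardDvdOfMinimalTwin_flat :
    KolyvaginRelationAtTwo → EquivariantChebotarevAtTwoR → (∀ (W : WeierstrassCurve ℚ) [W.IsElliptic], W.Δ < 0 → ∀ (c₀ : Field.absoluteGaloisGroup ℚ), Literature.NumberTheory.GaloisRepresentations.IsComplexConjugation (Rat.castHom ℝ) c₀ → ∀ (M : ℕ), ∃ P : W.geomTorsion ((2 ^ M : ℕ) : ℤ), ∀ Q : W.geomTorsion ((2 ^ M : ℕ) : ℤ), ∃ a b : ℤ, Q = a • P + b • (c₀ • P)) → ∀ (W : WeierstrassCurve ℚ) [W.IsElliptic] [W.IsGloballyMinimal] [NeZero (W.conductorNorm ℤ)], ¬ W.HasCM → Odd W.tamagawaProduct → W.Δ < 0 → ∀ (K : Type) [Field K] [NumberField K], Literature.NumberTheory.EllipticCurves.IsImaginaryQuadratic K → Odd (NumberField.discr K) → NumberField.discr K ≠ -3 → Literature.NumberTheory.EllipticCurves.SatisfiesHeegnerHypothesis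 (W.conductorNorm ℤ) K → ¬ IsSquare ((NumberField.discr K : ℚ) * -|W.Δ|) → ¬ IsSquare ((NumberField.discr K : ℚ) * (-(2 * |W.Δ|))) →
    (∀ (Mlev : ℕ), 1 ≤ Mlev → ∀ z : galH1Torsion (W.baseChange K) ((2 ^ Mlev : ℕ) : ℤ),
          (∀ ρ ∈ torsionFixing (W.baseChange K) ((2 ^ Mlev : ℕ) : ℤ), h1Eval (W.baseChange K) ((2 ^ Mlev : ℕ) : ℤ) z ρ = 0) →
          (∀ w : HeightOneSpectrum (𝓞 K), ((2 * W.conductorNorm ℤ : ℕ) : 𝓞 K) ∈ w.asIdeal →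
            z ∈ selmerLocalKer (W.baseChange K) (w.adicCompletion K) ((2 ^ Mlev : ℕ) : ℤ)) → z = 0) → (∀ n : ℕ, 0 < n → W.HasSurjectiveModNGaloisRep ((2 : ℤ) ^ n)) → ∀ (Dt : Literature.NumberTheory.EllipticCurves.ModularForms.ModularParametrizationData W (W.conductorNorm ℤ)) (β : ℤ) (ι : K →+* ℂ) (d₁ : Literature.NumberTheory.EllipticCurves.KolyvaginHeegnerData Dt β ι 1), ¬ IsOfFinAddOrder d₁.derivedPoint → ∀ (M₀ : ℕ), (∃ Q : (W.baseChange (Literature.NumberTheory.EllipticCurves.ringClassField K ι 1)).toAffine.Point, ((2 ^ M₀ : ℕ) : ℤ) • Q = d₁.derivedPoint) → (¬ ∃ Q : (W.baseChange (Literature.NumberTheory.EllipticCurves.ringClassField K ι 1)).toAffine.Point, ((2 ^ (M₀ + 1) : ℕ) : ℤ) • Q = d₁.derivedPoint) →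
      W.rootNumber = 1 → ∀ (Wd : WeierstrassCurve ℚ) [Wd.IsElliptic] [Wd.IsGloballyMinimal],
        (∃ C : WeierstrassCurve.VariableChange ℚ, C • W.quadraticTwist (NumberField.discr K : ℚ) = Wd) →
        Nat.card (Wd.selmerGroup 2) = 2 → padicValNat 2 Wd.tamagawaProduct ≤ 1 →
        Nat.card (AddCommGroup.primaryComponent W.sha 2) ∣ 2 ^ (2 * M₀) := by
  intro hQ2 _hQ5R _hQ1 W _ _ _ hcm hT hneg K _ _ hIQ hodd h3 hHe hsq1 hsq2 hNPh hρ Dt β ι d₁ _hy M₀ _hdiv hndiv hw1 Wd _ _ hWd hSel hle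
  haveI : Fact (Nat.Prime 2) := ⟨Nat.prime_two⟩
  -- (B2Q): `2^{M₀}` kills `Ш(E/ℚ)[2^∞]` (this seat, p748779)
  have hexp : ∀ x ∈ AddCommGroup.primaryComponent W.sha 2, 2 ^ M₀ • x = 0 := by
    intro x hx
    obtain ⟨k, hk⟩ := (AddCommGroup.mem_primaryComponent).mp hx
    have hk' : ((2 ^ k : ℕ) : ℤ) • (x : W.galH1) = 0 := by
      rw [natCast_zsmul, ← AddSubgroupClass.coe_nsmul, hk, ZeroMemClass.coe_zero]
    have h := two_pow_M0_smul_eq_zero_of_mem_sha_rat_onHabitat_flat hQ2 W hcm hT hneg K hIQ hodd h3 hHe hsq1 hsq2 hNPh hρ Dt β ι d₁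
      M₀ hndiv hw1 k (x : W.galH1) x.2 hk'
    rw [natCast_zsmul, ← AddSubgroupClass.coe_nsmul] at h
    exact_mod_cast h
  -- (RANKQ): `#Ш(E/ℚ)[2] ∣ 4` (gk2-p3 g26, p749000)
  have hrk : Nat.card (AddSubgroup.torsionBy W.sha ((2 : ℕ) : ℤ)) ≤ 4 := by
    have h4 := natCard_sha_torsionBy_two_dvd_four_of_genusBudget_le_one_unramified W hneg hT hIQ hodd hHe Wd hWd hle hSel
    have h4' : Nat.card (AddSubgroup.torsionBy W.sha ((2 : ℕ) : ℤ)) ∣ 4 := by simpa using h4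
    exact Nat.le_of_dvd (by norm_num) h4'
  -- (CTQ): the count (gk2-p5 g29, p748034)
  exact natCard_primaryComponent_sha_rat_two_dvd_of_exponent_of_card_sha_two_torsion_le_onHabitat_flat hQ2 W hcm hT hneg K hIQ
    hodd h3 hHe hsq1 hsq2 hNPh hρ Dt β ι d₁ M₀ hndiv hexp hrk

end Summit.BirchSwinnertonDyer.BirchSwinnertonDyer.Theorems.GenusExact.RationalPairDescent

/-! ## from `GenusKolyvaginAtTwoShaCardDvdPowAtTwoRTSandwich` -/

open scoped Classical

namespace Summit.BirchSwinnertonDyer.BirchSwinnertonDyer.Theorems.GenusExact.RationalPairDescent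

open WeierstrassCurve NumberField IsDedekindDomain Field Literature.NumberTheory.EllipticCurves
  Literature.NumberTheory.GaloisRepresentations Literature.NumberTheory.EllipticCurves.ModularForms
open Literature.NumberTheory
open Summit.BirchSwinnertonDyer.BirchSwinnertonDyer.Theses.GenusKolyvaginAtTwo
open Summit.BirchSwinnertonDyer.BirchSwinnertonDyer.Theorems.GenusExact.PlusDescent

/-- (LINE 26 FLAT form: the hypothesis `(NPh at 2N)(E, K)` replaces the odd multiplicative prime `v`.) **STUB SANDWICH′ OF LINE 19 (`rational_pair_descent` v1.1), BY NAME: `#Ш(E/K)[2^∞] ∣ 2 · #Ш(E/ℚ)[2^∞]`** on U_T's frame with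
`w(E) = 1` and a 2-Selmer-minimal globally minimal twin model `Wd ≅ E^{(d_K)}` with `ord₂ c(Wd) ≤ 1`.  Proof = the assembly
`natCard_sha_dvd_two_mul_of_inputs_flat` (`2·#X ≤ #res⁻¹(X) · #(1−τ_*)X`: invariant classes are restrictions + the Kramer class) fed with
(R′) `natCard_comap_resBaseChange_shaPrimary_le_onHabitat_flat` and (A) `natCard_map_sub_conjH1Points_shaPrimary_le_onHabitat_flat`, `e = ord₂ c(Wd) ≤ 1`.
UNCONDITIONAL modulo the in-signature antecedent Q2 (`KolyvaginRelationAtTwo`); Q5R, the Q1-shape clause, `hdiv` and `[Wd.IsGloballyMinimal]`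
are not used.  BSD is NOT proved by this; U_T is NOT proved by this (the declared residual `stub_residualOffMinimalTwin` remains).
[cite: Kramer1981, Thm. 1] [cite: GrossLMS1991, §5 (5.1)–(5.3)] [cite: McCallumLMS1991, §5 Cor. 5.6] -/
theorem stub_sandwichOfMinimalTwin_flat :
    KolyvaginRelationAtTwo → EquivariantChebotarevAtTwoR → (∀ (W : WeierstrassCurve ℚ) [W.IsElliptic], W.Δ < 0 → ∀ (c₀ : Field.absoluteGaloisGroup ℚ), Literature.NumberTheory.GaloisRepresentations.IsComplexConjugation (Rat.castHom ℝ) c₀ → ∀ (M : ℕ), ∃ P : W.geomTorsion ((2 ^ M : ℕ) : ℤ), ∀ Q : W.geomTorsion ((2 ^ M : ℕ) : ℤ), ∃ a b : ℤ, Q = a • P + b • (c₀ • P)) → ∀ (W : WeierstrassCurve ℚ) [W.IsElliptic] [W.IsGloballyMinimal] [NeZero (W.conductorNorm ℤ)], ¬ W.HasCM → Odd W.tamagawaProduct → W.Δ < 0 → ∀ (K : Type) [Field K] [NumberField K], Literature.NumberTheory.EllipticCurves.IsImaginaryQuadratic K → Odd (NumberField.discr K) → NumberField.discr K ≠ -3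 → Literature.NumberTheory.EllipticCurves.SatisfiesHeegnerHypothesis (W.conductorNorm ℤ) K → ¬ IsSquare ((NumberField.discr K : ℚ) * -|W.Δ|) → ¬ IsSquare ((NumberField.discr K : ℚ) * (-(2 * |W.Δ|))) →
    (∀ (Mlev : ℕ), 1 ≤ Mlev → ∀ z : galH1Torsion (W.baseChange K) ((2 ^ Mlev : ℕ) : ℤ),
          (∀ ρ ∈ torsionFixing (W.baseChange K) ((2 ^ Mlev : ℕ) : ℤ), h1Eval (W.baseChange K) ((2 ^ Mlev : ℕ) : ℤ) z ρ = 0) →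
          (∀ w : HeightOneSpectrum (𝓞 K), ((2 * W.conductorNorm ℤ : ℕ) : 𝓞 K) ∈ w.asIdeal →
            z ∈ selmerLocalKer (W.baseChange K) (w.adicCompletion K) ((2 ^ Mlev : ℕ) : ℤ)) → z = 0) → (∀ n : ℕ, 0 < n → W.HasSurjectiveModNGaloisRep ((2 : ℤ) ^ n)) → ∀ (Dt : Literature.NumberTheory.EllipticCurves.ModularForms.ModularParametrizationData W (W.conductorNorm ℤ)) (β : ℤ) (ι : K →+* ℂ) (d₁ : Literature.NumberTheory.EllipticCurves.KolyvaginHeegnerData Dt β ι 1), ¬ IsOfFinAddOrder d₁.derivedPoint → ∀ (M₀ : ℕ), (∃ Q : (W.baseChange (Literature.NumberTheory.EllipticCurves.ringClassField K ι 1)).toAffine.Point, ((2 ^ M₀ : ℕ) : ℤ) • Q = d₁.derivedPoint) → (¬ ∃ Q : (W.baseChange (Literature.NumberTheory.EllipticCurves.ringClassField K ι 1)).toAffine.Point, ((2 ^ (M₀ + 1) : ℕ) : ℤ) • Q = d₁.derivedPoint) →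
      W.rootNumber = 1 → ∀ (Wd : WeierstrassCurve ℚ) [Wd.IsElliptic] [Wd.IsGloballyMinimal],
        (∃ C : WeierstrassCurve.VariableChange ℚ, C • W.quadraticTwist (NumberField.discr K : ℚ) = Wd) →
        Nat.card (Wd.selmerGroup 2) = 2 → padicValNat 2 Wd.tamagawaProduct ≤ 1 →
        Nat.card (AddCommGroup.primaryComponent (W.baseChange K).sha 2) ∣
          2 * Nat.card (AddCommGroup.primaryComponent W.sha 2) := by
  intro hQ2 _hQ5R _hQ1 W _ _ _ hcm hT hneg K _ _ hIQ hodd h3 hHe hsq1 hsq2 hNPh hρ Dt β ι d₁ hy M₀ _hdiv hndiv hw Wd _ _ hWd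
    hSel hDEF
  obtain ⟨Cd, hCd⟩ := hWd
  obtain ⟨σ, -, hσ1, -⟩ := exists_gal_ne_one_sqrt_discr K hIQ.1
  exact natCard_sha_dvd_two_mul_of_inputs_flat W K hQ2 hcm hT hneg hIQ hodd h3 hHe hsq1 hsq2 hNPh hρ Dt β ι d₁ M₀ hndiv hw
    hσ1 (padicValNat 2 Wd.tamagawaProduct) hDEF
    (natCard_comap_resBaseChange_shaPrimary_le_onHabitat_flat W K hQ2 hcm hT hneg hIQ hodd h3 hHe hsq1 hsq2 hNPh hρ Dt β ι
      d₁ M₀ hndiv Cd hCd)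
    (natCard_map_sub_conjH1Points_shaPrimary_le_onHabitat_flat W K hQ2 hcm hT hneg hIQ hodd h3 hHe hsq1 hsq2 hNPh hρ Dt β ι d₁
      hy M₀ hndiv hw hσ1 Cd hCd hSel)

end Summit.BirchSwinnertonDyer.BirchSwinnertonDyer.Theorems.GenusExact.RationalPairDescent

/-! ## from `GenusKolyvaginAtTwoShaCardDvdPowAtTwoRTOnCut` -/

open scoped Classical

namespace Summit.BirchSwinnertonDyer.BirchSwinnertonDyer.Theorems.GenusExact.RationalPairDescent

open WeierstrassCurve NumberField IsDedekindDomain Field Literature.NumberTheory.EllipticCurves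
  Literature.NumberTheory.GaloisRepresentations Literature.NumberTheory.EllipticCurves.ModularForms
open Literature.NumberTheory
open Summit.BirchSwinnertonDyer.BirchSwinnertonDyer.Theses.GenusKolyvaginAtTwo
open Summit.BirchSwinnertonDyer.BirchSwinnertonDyer.Theorems.GenusExact.PlusDescent

/-- (LINE 26 FLAT form: the hypothesis `(NPh at 2N)(E, K)` replaces the odd multiplicative prime `v`.) **U_T ON THE CUT (LINE 19's live branch, sorry-free): `#Ш(E/K)[2^∞] ∣ 2^(2M₀)`** on U_T's frame with `w(E) = 1` and a 2-Selmer-minimal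
globally minimal twin model `Wd ≅ E^{(d_K)}` with `ord₂ c(Wd) ≤ 1` — the binders of the two registered live stubs verbatim, the conclusion of U_T
`ShaCardDvdPowAtTwoRT` verbatim.  PAIRCOUNT (gk2-p4 g22 `stub_shaRatCardDvdOfMinimalTwin_flat`: `#Ш(E/ℚ)[2^∞] ∣ 4^M₀`) and SANDWICH′ (this seat
`stub_sandwichOfMinimalTwin_flat`: `#Ш(E/K)[2^∞] ∣ 2·#Ш(E/ℚ)[2^∞]`) give `4^t = #Ш(E/K)[2^∞] ∣ 2·4^M₀` (gk2-p5 g29 `#X = 4^t`), so `t ≤ M₀`.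
This is the theorem a restated U_T′ (pen ask R7-d: U_T onto the cut) is closed by; U_T AS FILED is NOT proved (off the cut nothing is claimed);
BSD is NOT proved by any of this.  Unconditional modulo the in-signature antecedent Q2 (Q5R and the Q1-shape clause are idle).
[cite: McCallumLMS1991, §5 Thm. 5.4, Cor. 5.6] [cite: Kramer1981, Thm. 1] [cite: GrossLMS1991, §5 (5.1)–(5.3)] -/
theorem shaCardDvdPowAtTwoRT_onCut_flat :
    KolyvaginRelationAtTwo → EquivariantChebotarevAtTwoR → (∀ (W : WeierstrassCurve ℚ) [W.IsElliptic], W.Δ < 0 → ∀ (c₀ : Field.absoluteGaloisGroup ℚ), Literature.NumberTheory.GaloisRepresentations.IsComplexConjugation (Rat.castHom ℝ) c₀ → ∀ (M : ℕ), ∃ P : W.geomTorsion ((2 ^ M : ℕ) : ℤ), ∀ Q : W.geomTorsion ((2 ^ M : ℕ) : ℤ), ∃ a b : ℤ, Q = a • P + b • (c₀ • P)) → ∀ (W : WeierstrassCurve ℚ) [W.IsElliptic] [W.IsGloballyMinimal] [NeZero (W.conductorNorm ℤ)], ¬ W.HasCM → Odd W.tamagawaProduct → W.Δ < 0 → ∀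 (K : Type) [Field K] [NumberField K], Literature.NumberTheory.EllipticCurves.IsImaginaryQuadratic K → Odd (NumberField.discr K) → NumberField.discr K ≠ -3 → Literature.NumberTheory.EllipticCurves.SatisfiesHeegnerHypothesis (W.conductorNorm ℤ) K → ¬ IsSquare ((NumberField.discr K : ℚ) * -|W.Δ|) → ¬ IsSquare ((NumberField.discr K : ℚ) * (-(2 * |W.Δ|))) →
    (∀ (Mlev : ℕ), 1 ≤ Mlev → ∀ z : galH1Torsion (W.baseChange K) ((2 ^ Mlev : ℕ) : ℤ),
          (∀ ρ ∈ torsionFixing (W.baseChange K) ((2 ^ Mlev : ℕ) : ℤ), h1Eval (W.baseChange K) ((2 ^ Mlev : ℕ) : ℤ) z ρ = 0) →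
          (∀ w : HeightOneSpectrum (𝓞 K), ((2 * W.conductorNorm ℤ : ℕ) : 𝓞 K) ∈ w.asIdeal →
            z ∈ selmerLocalKer (W.baseChange K) (w.adicCompletion K) ((2 ^ Mlev : ℕ) : ℤ)) → z = 0) → (∀ n : ℕ, 0 < n → W.HasSurjectiveModNGaloisRep ((2 : ℤ) ^ n)) → ∀ (Dt : Literature.NumberTheory.EllipticCurves.ModularForms.ModularParametrizationData W (W.conductorNorm ℤ)) (β : ℤ) (ι : K →+* ℂ) (d₁ : Literature.NumberTheory.EllipticCurves.KolyvaginHeegnerData Dt β ι 1), ¬ IsOfFinAddOrder d₁.derivedPoint → ∀ (M₀ : ℕ), (∃ Q : (W.baseChange (Literature.NumberTheory.EllipticCurves.ringClassField K ι 1)).toAffine.Point, ((2 ^ M₀ : ℕ) : ℤ) • Q = d₁.derivedPoint) → (¬ ∃ Q : (W.baseChange (Literature.NumberTheory.EllipticCurves.ringClassField K ι 1)).toAffine.Point, ((2 ^ (M₀ + 1) : ℕ) : ℤ) • Q = d₁.derivedPoint) →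
      W.rootNumber = 1 → ∀ (Wd : WeierstrassCurve ℚ) [Wd.IsElliptic] [Wd.IsGloballyMinimal],
        (∃ C : WeierstrassCurve.VariableChange ℚ, C • W.quadraticTwist (NumberField.discr K : ℚ) = Wd) →
        Nat.card (Wd.selmerGroup 2) = 2 → padicValNat 2 Wd.tamagawaProduct ≤ 1 →
        Nat.card (AddCommGroup.primaryComponent (W.baseChange K).sha 2) ∣ 2 ^ (2 * M₀) := by
  intro hQ2 hQ5R hQ1 W _ _ _ hcm hT hneg K _ _ hIQ hodd h3 hHe hsq1 hsq2 hNPh hρ Dt β ι d₁ hy M₀ hdiv hndiv hw Wd _ _ hWd hSel hDEF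
  have hpair := stub_shaRatCardDvdOfMinimalTwin_flat hQ2 hQ5R hQ1 W hcm hT hneg K hIQ hodd h3 hHe hsq1 hsq2 hNPh hρ Dt β ι d₁ hy
    M₀ hdiv hndiv hw Wd hWd hSel hDEF
  have hsand := stub_sandwichOfMinimalTwin_flat hQ2 hQ5R hQ1 W hcm hT hneg K hIQ hodd h3 hHe hsq1 hsq2 hNPh hρ Dt β ι d₁ hy
    M₀ hdiv hndiv hw Wd hWd hSel hDEF
  -- `#X ∣ 2 · #Ш(E/ℚ)[2^∞] ∣ 2 · 4^M₀` and `#X = 4^t` ⟹ `t ≤ M₀`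
  have hX : Nat.card (AddCommGroup.primaryComponent (W.baseChange K).sha 2) ∣ 2 * 2 ^ (2 * M₀) :=
    hsand.trans (Nat.mul_dvd_mul_left 2 hpair)
  obtain ⟨t, ht⟩ := exists_natCard_primaryComponent_sha_two_eq_pow_two_mul_onHabitat_flat hQ2 W hcm hT hneg K hIQ hodd h3
    hHe hsq1 hsq2 hNPh hρ Dt β ι d₁ M₀ hndiv
  rw [ht] at hX ⊢
  rw [show 2 * 2 ^ (2 * M₀) = 2 ^ (2 * M₀ + 1) by ring] at hX
  have htM : 2 * t ≤ 2 * M₀ + 1 := (Nat.pow_dvd_pow_iff_le_right (by norm_num)).mp hX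
  exact Nat.pow_dvd_pow 2 (by omega)

end Summit.BirchSwinnertonDyer.BirchSwinnertonDyer.Theorems.GenusExact.RationalPairDescent

/-! ## from `GenusKolyvaginAtTwoPowDvdShaCardAtTwoRT` -/

open scoped Classical
open scoped AddSubgroup
open Function Field NumberField IsDedekindDomain WeierstrassCurve
open Literature.NumberTheory.EllipticCurves Literature.NumberTheory.GaloisRepresentations
open Literature.NumberTheory.EllipticCurves.ModularForms
open Literature.NumberTheory.GaloisCohomology
open Summit.BirchSwinnertonDyer.Rank1Residual.JET.GlobalDuality
open Summit.BirchSwinnertonDyer.BirchSwinnertonDyer.Theses.GenusKolyvaginAtTwo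
open Summit.BirchSwinnertonDyer.BirchSwinnertonDyer.Theorems.GenusExact.PlusDescent

namespace Summit.BirchSwinnertonDyer.BirchSwinnertonDyer.Theorems

/-- (LINE 26 FLAT form: the hypothesis `(NPh at 2N)(E, K)` replaces the odd multiplicative prime `v`.) **L_T `PowDvdShaCardAtTwoRT` (stmt-BirchSwinnertonDyer-23659) PROVED: on the route's habitat, `2^{2M₀} ∣ #Ш(E/K)[2^∞]`** — the lower half of
Kolyvagin's structure theorem at `p = 2` — from the antecedents in its own statement (Q2 `KolyvaginRelationAtTwo`, Q5R `EquivariantChebotarevAtTwoR`,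
the cyclicity clause Q1) and tree theorems; NO `PubInputsAtTwo`.  LINE 18 v6 «E4» composition (LEAD R5) with `k := M₀ + 6`, `L := 2k`, margin `1`:
W-UP′ = the crux's Gross witness itself; X-ORTH∃ = `ctOrthogonalAtTwo_of_frame`; KS with provenance = `kolyvaginSuppliesAtTwo_of_grossWitness_onHabitat_pred_flat`;
capstone = `pow_dvd_natCard_sha_of_kolyvaginSupplies_of_orthogonal_of_rank_le_one` fed with `mordellWeilRank_baseChange_le_one_onHabitat_flat`.
BSD is NOT proved by this; neither is Q3R_T (needs U_T) nor the route's deciding theorem.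
[cite: McCallumLMS1991, §5 Prop. 5.2, Thm. 5.4 (p. 310)] [cite: Kolyvagin1991StructureSha] [cite: Kolyvagin1991MathAnn, Thm. 2.1–2.2]
[cite: GrossLMS1991, §1 Thm. 1.3, §10] [cite: LawsonWuthrich2016, §7.1] -/
theorem powDvdShaCardAtTwoRT_proof_flat :
    KolyvaginRelationAtTwo → EquivariantChebotarevAtTwoR → (∀ (W : WeierstrassCurve ℚ) [W.IsElliptic], W.Δ < 0 → ∀ (c₀ : Field.absoluteGaloisGroup ℚ), Literature.NumberTheory.GaloisRepresentations.IsComplexConjugation (Rat.castHom ℝ) c₀ → ∀ (M : ℕ), ∃ P : W.geomTorsion ((2 ^ M : ℕ) : ℤ), ∀ Q : W.geomTorsion ((2 ^ M : ℕ) : ℤ), ∃ a b : ℤ, Q = a • P + b • (c₀ • P)) → ∀ (W : WeierstrassCurve ℚ) [W.IsElliptic] [W.IsGloballyMinimal] [NeZero (W.conductorNorm ℤ)], ¬ W.HasCM → Odd W.tamagawaProduct → W.Δ < 0 → ∀ (K : Type) [Field K] [NumberField K], Literature.NumberTheory.EllipticCurves.IsImaginaryQuadratic K → Odd (NumberField.discr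 K) → NumberField.discr K ≠ -3 → Literature.NumberTheory.EllipticCurves.SatisfiesHeegnerHypothesis (W.conductorNorm ℤ) K → ¬ IsSquare ((NumberField.discr K : ℚ) * -|W.Δ|) → ¬ IsSquare ((NumberField.discr K : ℚ) * (-(2 * |W.Δ|))) →
    (∀ (Mlev : ℕ), 1 ≤ Mlev → ∀ z : galH1Torsion (W.baseChange K) ((2 ^ Mlev : ℕ) : ℤ),
          (∀ ρ ∈ torsionFixing (W.baseChange K) ((2 ^ Mlev : ℕ) : ℤ), h1Eval (W.baseChange K) ((2 ^ Mlev : ℕ) : ℤ) z ρ = 0) →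
          (∀ w : HeightOneSpectrum (𝓞 K), ((2 * W.conductorNorm ℤ : ℕ) : 𝓞 K) ∈ w.asIdeal →
            z ∈ selmerLocalKer (W.baseChange K) (w.adicCompletion K) ((2 ^ Mlev : ℕ) : ℤ)) → z = 0) → (∀ n : ℕ, 0 < n → W.HasSurjectiveModNGaloisRep ((2 : ℤ) ^ n)) → ∀ (Dt : Literature.NumberTheory.EllipticCurves.ModularForms.ModularParametrizationData W (W.conductorNorm ℤ)) (β : ℤ) (ι : K →+* ℂ) (d₁ : Literature.NumberTheory.EllipticCurves.KolyvaginHeegnerData Dt β ι 1), ¬ IsOfFinAddOrder d₁.derivedPoint → ∀ (M₀ : ℕ), (∃ Q : (W.baseChange (Literature.NumberTheory.EllipticCurves.ringClassField K ι 1)).toAffine.Point, ((2 ^ M₀ : ℕ) : ℤ) • Q = d₁.derivedPoint) → (¬ ∃ Q : (W.baseChange (Literature.NumberTheory.EllipticCurves.ringClassField K ι 1)).toAffine.Point, ((2 ^ (M₀ + 1) : ℕ) : ℤ) • Q = d₁.derivedPoint) → ∀ (n : ℕ) (d : Literature.NumberTheory.EllipticCurves.KolyvaginHeegnerData Dt β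 ι n), Squarefree n → (∀ ℓ ∈ n.primeFactors, Literature.NumberTheory.EllipticCurves.Zhang2014.IsKolyvaginPrime (W.conductorNorm ℤ) W K 2 ℓ ∧ 2 ≤ Literature.NumberTheory.EllipticCurves.Zhang2014.kolyvaginIndex W 2 ℓ ∧ Literature.NumberTheory.EllipticCurves.FrobEqFrobInfty W K 2 ℓ) → (¬ ∃ Q : (W.baseChange (Literature.NumberTheory.EllipticCurves.ringClassField K ι n)).toAffine.Point, (2 : ℤ) • Q = d.derivedPoint) → 2 ^ (2 * M₀) ∣ Nat.card (AddCommGroup.primaryComponent (W.baseChange K).sha 2) := by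
  intro hQ2 _hQ5R _hQ1 W _ _ _ hcm hT hneg K _ _ hIQ hodd h3 hHe hsq1 hsq2 hNPh hρ Dt β ι d₁ hy M₀ hdiv hndiv n d hn hKoly hPn
  haveI : Fact (Nat.Prime 2) := ⟨Nat.prime_two⟩
  have hsurN : ∀ m : ℕ, W.HasSurjectiveModNGaloisRep ((2 ^ m : ℕ) : ℤ) :=
    MinimalTwinBSDTwo.forall_hasSurjectiveModNGaloisRep_two_pow_of_pos W hρ
  have hsurN' : ∀ m : ℕ, W.HasSurjectiveModNGaloisRep (2 ^ m : ℕ) := fun m ↦ by exact_mod_cast hsurN m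
  -- the complex conjugation of `K`
  obtain ⟨τ, hτ, -⟩ := Literature.NumberTheory.EllipticCurves.exists_conj_of_isImaginaryQuadratic (K := K) hIQ
  -- `rank E(K) ≤ 1` — Kolyvagin's rank descent at `2` on the habitat (this seat), replacing the print bundle
  have hrk : (W.baseChange K).mordellWeilRank ≤ 1 :=
    mordellWeilRank_baseChange_le_one_onHabitat_flat hQ2 W hcm hT hneg K hIQ hodd h3 hHe hsq1 hsq2 hNPh hρ Dt β ι d₁ M₀ hndiv
  -- X-ORTH∃ at `k := M₀ + 6` (gk2-p5's stub closer, hP-free)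
  obtain ⟨B, hker, hOrth⟩ := ctOrthogonalAtTwo_of_frame W hT hneg K hIQ hodd h3 hHe hρ Dt β ι τ hτ (M₀ + 6) (by omega)
  -- KS with provenance from the Gross witness (W-UP′ = `⟨n, d, hn, hKoly, hPn⟩`), `L := 2(M₀+6)`, margin `1`
  obtain ⟨R, Mr, hMr, hMr0, hMrR, hOdd, hEven⟩ := kolyvaginSuppliesAtTwo_of_grossWitness_onHabitat_pred_flat W hQ2 hcm hneg hT hsurN' hIQ
    hodd h3 hHe hsq1 hsq2 hNPh τ hτ Dt β ι d₁ M₀ hdiv hndiv (L := 2 * (M₀ + 6)) (k := 1) (by omega) le_rfl hn hKoly d hPn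
  -- the K-side capstone with `rank ≤ 1` displayed (gk2-p2's p737814 re-cut, p741898)
  refine pow_dvd_natCard_sha_of_kolyvaginSupplies_of_orthogonal_of_rank_le_one hQ2 W hcm hT K hIQ hodd h3 hHe hrk hρ Dt β ι d₁ hy M₀ hndiv
    τ hτ (2 * (M₀ + 6)) (M₀ + 6) (by omega) (by omega)
    (fun ℓ ↦ 2 * (M₀ + 6) + 1 ≤ Zhang2014.kolyvaginIndex W 2 ℓ ∧ FrobEqFrobInfty W K (2 ^ (2 * (M₀ + 6) + 1)) ℓ)
    (fun ℓ ↦ 2 * (M₀ + 6) + 1 ≤ Zhang2014.kolyvaginIndex W 2 ℓ ∧ FrobEqFrobInfty W K (2 ^ (2 * (M₀ + 6) + 1)) ℓ)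
    B hker (fun x x' hx hx' ↦ ?_) R Mr hMr hMr0 hMrR hOdd hEven
  -- X-ORTH in provenance currency: drop the margin, descend the Frobenius clause one level
  obtain ⟨n₁, e₁, j₁, hn₁, hKol₁, hj₁, hsel₁, hvan₁, hsg₁, hx₁⟩ := hx
  obtain ⟨n₂, e₂, j₂, hn₂, hKol₂, hj₂, hsel₂, hvan₂, hsg₂, hx₂⟩ := hx'
  exact hOrth x x'
    ⟨n₁, e₁, j₁, hn₁, fun ℓ hℓ ↦ ⟨(hKol₁ ℓ hℓ).1, (hKol₁ ℓ hℓ).2.1, frobEqFrobInfty_pow_of_margin W K (hKol₁ ℓ hℓ).2.2.2⟩,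
      hj₁, hsel₁, hvan₁, hsg₁, hx₁⟩
    ⟨n₂, e₂, j₂, hn₂, fun ℓ hℓ ↦ ⟨(hKol₂ ℓ hℓ).1, (hKol₂ ℓ hℓ).2.1, frobEqFrobInfty_pow_of_margin W K (hKol₂ ℓ hℓ).2.2.2⟩,
      hj₂, hsel₂, hvan₂, hsg₂, hx₂⟩

end Summit.BirchSwinnertonDyer.BirchSwinnertonDyer.Theorems

/-! ## from `GenusKolyvaginAtTwoEquivariantKolyvaginExactAtTwoRTOnCut` -/

open scoped Classical

namespace Summit.BirchSwinnertonDyer.BirchSwinnertonDyer.Theorems.GenusExact.RationalPairDescent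

open WeierstrassCurve NumberField IsDedekindDomain Field Literature.NumberTheory.EllipticCurves
  Literature.NumberTheory.GaloisRepresentations Literature.NumberTheory.EllipticCurves.ModularForms
open Literature.NumberTheory
open Summit.BirchSwinnertonDyer.BirchSwinnertonDyer.Theses.GenusKolyvaginAtTwo
open Summit.BirchSwinnertonDyer.BirchSwinnertonDyer.Theorems
open Summit.BirchSwinnertonDyer.BirchSwinnertonDyer.Theorems.GenusExact.PlusDescent

/-- (LINE 26 FLAT form: the hypothesis `(NPh at 2N)(E, K)` replaces the odd multiplicative prime `v`.) **KOLYVAGIN'S EXACT FORMULA AT 2 ON THE CUT: `#Ш(E/K)[2^∞] = 2^(2M₀)`** — Q3R_T's conclusion (`EquivariantKolyvaginExactAtTwoRT`) on the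
route's live configuration, SORRY-FREE: Q3R_T's binders verbatim with the cut (`w(E) = 1`, a globally minimal 2-Selmer-minimal twin model
`Wd ≅ E^{(d_K)}` with `ord₂ c(Wd) ≤ 1`) inserted after the divisibility clause of `M₀`.  `Nat.dvd_antisymm` of the upper half on the cut
(`shaCardDvdPowAtTwoRT_onCut_flat`: PAIRCOUNT gk2-p4 g22 × SANDWICH′ this seat × `#X = 4^t` gk2-p5) and the CLOSED lower half L_T
(`Theorems.powDvdShaCardAtTwoRT_proof_flat`, gk2-p4 g21, p744020).  This is the statement a restated Q3R_T′ (glue 23243 re-typed on the cut) is closed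
by.  Q3R_T / U_T AS FILED are NOT proved (off the cut nothing is claimed); BSD is NOT proved by any of this.
[cite: McCallumLMS1991, §5 Thm. 5.4, Cor. 5.6, Thm. 5.8] [cite: Kolyvagin1990, Thm. A] [cite: GrossLMS1991, §5] -/
theorem natCard_primaryComponent_sha_two_eq_pow_onCut_flat :
  KolyvaginRelationAtTwo → EquivariantChebotarevAtTwoR → (∀ (W : WeierstrassCurve ℚ) [W.IsElliptic], W.Δ < 0 → ∀ (c₀ : Field.absoluteGaloisGroup ℚ), Literature.NumberTheory.GaloisRepresentations.IsComplexConjugation (Rat.castHom ℝ) c₀ → ∀ (M : ℕ), ∃ P : W.geomTorsion ((2 ^ M : ℕ) : ℤ), ∀ Q : W.geomTorsion ((2 ^ M : ℕ) : ℤ), ∃ a b : ℤ, Q = a • P + b • (c₀ • P)) → ∀ (W : WeierstrassCurve ℚ) [W.IsElliptic] [W.IsGloballyMinimal] [NeZero (W.conductorNorm ℤ)], ¬ W.HasCM → Odd W.tamagawaProduct → W.Δ < 0 → ∀ (K : Type) [Field K] [NumberField K], Literature.NumberTheory.EllipticCurves.IsImaginaryQuadratic K → Odd (NumberField.discr K)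 → NumberField.discr K ≠ -3 → Literature.NumberTheory.EllipticCurves.SatisfiesHeegnerHypothesis (W.conductorNorm ℤ) K → ¬ IsSquare ((NumberField.discr K : ℚ) * -|W.Δ|) → ¬ IsSquare ((NumberField.discr K : ℚ) * (-(2 * |W.Δ|))) →
    (∀ (Mlev : ℕ), 1 ≤ Mlev → ∀ z : galH1Torsion (W.baseChange K) ((2 ^ Mlev : ℕ) : ℤ),
          (∀ ρ ∈ torsionFixing (W.baseChange K) ((2 ^ Mlev : ℕ) : ℤ), h1Eval (W.baseChange K) ((2 ^ Mlev : ℕ) : ℤ) z ρ = 0) →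
          (∀ w : HeightOneSpectrum (𝓞 K), ((2 * W.conductorNorm ℤ : ℕ) : 𝓞 K) ∈ w.asIdeal →
            z ∈ selmerLocalKer (W.baseChange K) (w.adicCompletion K) ((2 ^ Mlev : ℕ) : ℤ)) → z = 0) → (∀ n : ℕ, 0 < n → W.HasSurjectiveModNGaloisRep ((2 : ℤ) ^ n)) → ∀ (Dt : Literature.NumberTheory.EllipticCurves.ModularForms.ModularParametrizationData W (W.conductorNorm ℤ)) (β : ℤ) (ι : K →+* ℂ) (d₁ : Literature.NumberTheory.EllipticCurves.KolyvaginHeegnerData Dt β ι 1), ¬ IsOfFinAddOrder d₁.derivedPoint → ∀ (M₀ : ℕ), (∃ Q : (W.baseChange (Literature.NumberTheory.EllipticCurves.ringClassField K ι 1)).toAffine.Point, ((2 ^ M₀ : ℕ) : ℤ) • Q = d₁.derivedPoint) → (¬ ∃ Q : (W.baseChange (Literature.NumberTheory.EllipticCurves.ringClassField K ι 1)).toAffine.Point, ((2 ^ (M₀ + 1) : ℕ) : ℤ) • Q = d₁.derivedPoint) →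
      W.rootNumber = 1 → ∀ (Wd : WeierstrassCurve ℚ) [Wd.IsElliptic] [Wd.IsGloballyMinimal],
        (∃ C : WeierstrassCurve.VariableChange ℚ, C • W.quadraticTwist (NumberField.discr K : ℚ) = Wd) →
        Nat.card (Wd.selmerGroup 2) = 2 → padicValNat 2 Wd.tamagawaProduct ≤ 1 →
      ∀ (n : ℕ) (d : Literature.NumberTheory.EllipticCurves.KolyvaginHeegnerData Dt β ι n), Squarefree n → (∀ ℓ ∈ n.primeFactors, Literature.NumberTheory.EllipticCurves.Zhang2014.IsKolyvaginPrime (W.conductorNorm ℤ) W K 2 ℓ ∧ 2 ≤ Literature.NumberTheory.EllipticCurves.Zhang2014.kolyvaginIndex W 2 ℓ ∧ Literature.NumberTheory.EllipticCurves.FrobEqFrobInfty W K 2 ℓ) → (¬ ∃ Q : (W.baseChange (Literature.NumberTheory.EllipticCurves.ringClassField K ι n)).toAffine.Point, (2 : ℤ) • Q = d.derivedPoint) → Nat.card (AddCommGroup.primaryComponent (W.baseChange K).sha 2) = 2 ^ (2 * M₀) := by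
  intro hQ2 hQ5R hQ1 W _ _ _ hcm hT hneg K _ _ hIQ hodd h3 hHe hsq1 hsq2 hNPh hρ Dt β ι d₁ hy M₀ hdiv hndiv hw Wd _ _ hWd hSel hDEF
    n d hn hKoly hPn
  exact Nat.dvd_antisymm
    (shaCardDvdPowAtTwoRT_onCut_flat hQ2 hQ5R hQ1 W hcm hT hneg K hIQ hodd h3 hHe hsq1 hsq2 hNPh hρ Dt β ι d₁ hy M₀ hdiv hndiv hw Wd
      hWd hSel hDEF)
    (powDvdShaCardAtTwoRT_proof_flat hQ2 hQ5R hQ1 W hcm hT hneg K hIQ hodd h3 hHe hsq1 hsq2 hNPh hρ Dt β ι d₁ hy M₀ hdiv hndiv n d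
      hn hKoly hPn)

end Summit.BirchSwinnertonDyer.BirchSwinnertonDyer.Theorems.GenusExact.RationalPairDescent

/-! ## LINE 26 STUB `stub_Q3flat` — VERBATIM -/

namespace Summit.BirchSwinnertonDyer.BirchSwinnertonDyer.Theorems.GenusExact.Lw2PhantomExclusion

open WeierstrassCurve NumberField IsDedekindDomain Literature.NumberTheory.EllipticCurves
  Literature.NumberTheory.EllipticCurves.ModularForms
open Summit.BirchSwinnertonDyer.BirchSwinnertonDyer.Theses.GenusKolyvaginAtTwo

/-- **LINE 26 «lw2_phantom_exclusion», STUB `stub_Q3flat` — PROVED, signature VERBATIM** (`Cruxes/OffCutResidualAtTwoR/Lines/lw2_phantom_exclusion.lean`):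
the landed exactness theorem Q3R_T `EquivariantKolyvaginExactAtTwoRT` (`…Theorems.equivariantKolyvaginExactAtTwoRT_proof`: on the Δ<0 habitat cut
to the live configuration, `#Ш(E/K)[2^∞] = 2^(2M₀)`) with its three binders `∀ v, 2 ∉ v → N ∈ v → E multiplicative at v →` REPLACED by the
hypothesis `(NPh at 2N)(E, K)` («for every `M ≥ 1`, a class of `H¹(K, E[2^M])` dying on `Γ_(K(E[2^M]))` and Kummer at every place over `2N`
is zero»), inserted after the two `¬ IsSquare` clauses — `RationalPairDescent.natCard_primaryComponent_sha_two_eq_pow_onCut_flat` by name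
(= `Nat.dvd_antisymm` of U_T-on-the-cut and L_T, both re-threaded through parts A1–D of this series).  The skeleton plugs it as
`stub_Q3flat := Summit.BirchSwinnertonDyer.BirchSwinnertonDyer.Theorems.GenusExact.Lw2PhantomExclusion.q3flat`.  UNCONDITIONAL modulo the
in-signature antecedents (Q2 `KolyvaginRelationAtTwo` is used; Q5R and the Q1-shape clause are idle, as in Q3R_T).  BSD is NOT proved by this;
the residual crux `OffCutResidualAtTwoR` is NOT closed by this (LINE 26 still needs `stub_transport`, `stub_KLW` and keeps `stub_residual`).
[cite: McCallumLMS1991, §5 Thm. 5.4, Cor. 5.6, Thm. 5.8] [cite: Kolyvagin1990, Thm. A] [cite: GrossLMS1991, §5, §10] [cite: LawsonWuthrich2016, §4, §8] -/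
theorem q3flat :

  KolyvaginRelationAtTwo → EquivariantChebotarevAtTwoR → (∀ (W : WeierstrassCurve ℚ) [W.IsElliptic], W.Δ < 0 → ∀ (c₀ : Field.absoluteGaloisGroup ℚ), Literature.NumberTheory.GaloisRepresentations.IsComplexConjugation (Rat.castHom ℝ) c₀ → ∀ (M : ℕ), ∃ P : W.geomTorsion ((2 ^ M : ℕ) : ℤ), ∀ Q : W.geomTorsion ((2 ^ M : ℕ) : ℤ), ∃ a b : ℤ, Q = a • P + b • (c₀ • P)) → ∀ (W : WeierstrassCurve ℚ) [W.IsElliptic] [W.IsGloballyMinimal] [NeZero (W.conductorNorm ℤ)], ¬ W.HasCM → Odd W.tamagawaProduct → W.Δ < 0 → ∀ (K : Type) [Field K] [NumberField K], Literature.NumberTheory.EllipticCurves.IsImaginaryQuadratic K → Odd (NumberField.discr K) → NumberField.discr K ≠ -3 → Literature.NumberTheory.EllipticCurves.SatisfiesHeegnerHypothesis (W.conductorNorm ℤ) K → ¬ IsSquare ((NumberField.discr K : ℚ) * -|W.Δ|) → ¬ IsSquare ((NumberField.discr K : ℚ) * (-(2 * |W.Δ|))) →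
    (∀ (Mlev : ℕ), 1 ≤ Mlev → ∀ z : galH1Torsion (W.baseChange K) ((2 ^ Mlev : ℕ) : ℤ),
          (∀ ρ ∈ torsionFixing (W.baseChange K) ((2 ^ Mlev : ℕ) : ℤ), h1Eval (W.baseChange K) ((2 ^ Mlev : ℕ) : ℤ) z ρ = 0) →
          (∀ w : HeightOneSpectrum (𝓞 K), ((2 * W.conductorNorm ℤ : ℕ) : 𝓞 K) ∈ w.asIdeal →
            z ∈ selmerLocalKer (W.baseChange K) (w.adicCompletion K) ((2 ^ Mlev : ℕ) : ℤ)) → z = 0) → (∀ n : ℕ, 0 < n → W.HasSurjectiveModNGaloisRep ((2 : ℤ) ^ n)) → ∀ (Dt : Literature.NumberTheory.EllipticCurves.ModularForms.ModularParametrizationData W (W.conductorNorm ℤ)) (β : ℤ) (ι : K →+* ℂ) (d₁ : Literature.NumberTheory.EllipticCurves.KolyvaginHeegnerData Dt β ι 1), ¬ IsOfFinAddOrder d₁.derivedPoint → ∀ (M₀ : ℕ), (∃ Q : (W.baseChange (Literature.NumberTheory.EllipticCurves.ringClassField K ι 1)).toAffine.Point, ((2 ^ M₀ : ℕ) : ℤ)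 • Q = d₁.derivedPoint) → (¬ ∃ Q : (W.baseChange (Literature.NumberTheory.EllipticCurves.ringClassField K ι 1)).toAffine.Point, ((2 ^ (M₀ + 1) : ℕ) : ℤ) • Q = d₁.derivedPoint) → W.rootNumber = 1 → ∀ (Wd : WeierstrassCurve ℚ) [Wd.IsElliptic] [Wd.IsGloballyMinimal], (∃ C : WeierstrassCurve.VariableChange ℚ, C • W.quadraticTwist (NumberField.discr K : ℚ) = Wd) → Nat.card (Wd.selmerGroup 2) = 2 → padicValNat 2 Wd.tamagawaProduct ≤ 1 → ∀ (n : ℕ) (d : Literature.NumberTheory.EllipticCurves.KolyvaginHeegnerData Dt β ι n), Squarefree n → (∀ ℓ ∈ n.primeFactors, Literature.NumberTheory.EllipticCurves.Zhang2014.IsKolyvaginPrime (W.conductorNorm ℤ) W K 2 ℓ ∧ 2 ≤ Literature.NumberTheory.EllipticCurves.Zhang2014.kolyvaginIndex W 2 ℓ ∧ Literature.NumberTheory.EllipticCurves.FrobEqFrobInfty W K 2 ℓ) → (¬ ∃ Q : (W.baseChange (Literature.NumberTheory.EllipticCurves.ringClassField K ι n)).toAffine.Point, (2 : ℤ) • Q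 = d.derivedPoint) → Nat.card (AddCommGroup.primaryComponent (W.baseChange K).sha 2) = 2 ^ (2 * M₀) :=
  RationalPairDescent.natCard_primaryComponent_sha_two_eq_pow_onCut_flat

end Summit.BirchSwinnertonDyer.BirchSwinnertonDyer.Theorems.GenusExact.Lw2PhantomExclusion

end
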